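import Summits.ResolutionOfSingularities.ResolutionOfSingularities.Theorems.ValuativeLuAlphaPTorsorColengthDrop
import Literature.RingTheory.HilbertSamuel.LocalRing
import Literature.RingTheory.HilbertSamuel.RegularLocalRing

/-!
# The sharp colength drop of the weak transform, and the lengths `λ(R/𝔪ᵐ)` (Giraud 2.3 (B))

Helper file for the stubs `length_quotient_weakTransform_map_add_length_le` (V3, the SHARP
per-point colength drop `λ_T(T/Jᵀ) + λ_R(R/𝔪ʳ) ≤ λ_R(R/J)`) and
`length_quotient_pow_maximalIdeal_ge` (V4, `λ(R/𝔪) = 1` and `λ(R/𝔪ᵐ) ≥ m + 1` for `m ≥ 2` in a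
two-dimensional regular local ring) of the line `pfaff-line-log-final-forms` (crux
`Valuative.LuAlphaPTorsor`, item `stmt-ResolutionOfSingularities-0641`).

Setting of V3 (as in `ValuativeLuAlphaPTorsorColengthDrop.lean`): `(R, 𝔪 = (x, y))` a
two-dimensional regular local subring of the field `K`, `A = R[y/x] ⊆ K` the chart of the blowing
up of the closed point (`chartAdjoin`, `ι = chartIncl x y`, `𝔪A = xA`), `J ⊆ 𝔪ʳ`, `J ⊄ 𝔪ʳ⁺¹` an
ideal of finite colength, `Jᴬ = (JA : xʳ)` its weak transform (`weakTransformChart`) and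
`T = A_Q`. The strict drop `λ_T(T/JᴬT) < λ_R(R/J)` of the landed file passes through
`λ_T(T/JᴬT) ≤ λ_A(A/Jᴬ) ≤ λ_R(𝔪ʳ/J)`; here the last module is compared with `R/J` through the
exact sequence `0 → 𝔪ʳ/J → R/J → R/𝔪ʳ → 0` (additivity of length) instead of the strict
inclusion `𝔪ʳ/J ⊊ R/J`, which gives the quantitative form
`λ_T(T/JᴬT) + λ_R(R/𝔪ʳ) ≤ λ_R(R/J)` needed in Giraud's Lemme 2.3, case (B).

* `length_quotient_transform_add_length_le_of_forall_exists` — the abstract Huneke–Swanson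
  14.3.4 in sharp form, with the surjectivity of `𝔪ʳ → xʳS/JS` as a hypothesis;
* `length_quotient_weakTransform_map_add_length_le` — V3;
* `hilbertFun_eq_of_ringKrullDim_eq_two` — `H⁽⁰⁾_R(i) = i + 1` for a two-dimensional regular
  local ring (`ℓ(𝔪ⁱ/𝔪ⁱ⁺¹) = binom(i + 1, i)`, CJS Lemma 2.23);
* `length_quotient_pow_maximalIdeal_ge` — V4: `λ(R/𝔪ⁿ⁺¹) = Σ_{i ≤ n} (i + 1) ≥ n + 2` for `n ≥ 1`.

References: J. Giraud, *Forme normale d'une fonction sur une surface de caractéristique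
positive*, Bull. SMF 111 (1983), Lemme 2.1.1, Lemme 2.3; C. Huneke, I. Swanson,
*Integral Closure of Ideals, Rings, and Modules* (2006), Lemma 14.3.4; V. Cossart, U. Jannsen,
S. Saito, LNM 2270 (2020), §2.2 and Lemma 2.23.
-/

set_option linter.dupNamespace false

noncomputable section

open IsLocalRing Literature.AlgebraicGeometry.Resolution Literature.RingTheory.HilbertSamuel

namespace Summit.ResolutionOfSingularities.ResolutionOfSingularities.Theorems.PfaffLine

section Abstract

variable {R : Type*} [CommRing R] [IsLocalRing R] {S : Type*} [CommRing S] [Algebra R S] {x : R}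

/-- **Huneke–Swanson 14.3.4, sharp abstract form with the surjectivity of `𝔪ʳ → xʳS/JS` as a
hypothesis.** Let `R → S` with `𝔪S = xS`, `J ⊆ 𝔪ʳ`, and suppose every `xʳ s` (`s ∈ S`) is
congruent modulo `JS` to the image of an element of `𝔪ʳ`. Then
`λ_S(S/(JS : xʳ)) + λ_R(R/𝔪ʳ) ≤ λ_R(R/J)`: `S/(JS : xʳ) ≅ xʳS/JS` is an `R`-quotient of `𝔪ʳ/J`,
and `λ_R(𝔪ʳ/J) + λ_R(R/𝔪ʳ) = λ_R(R/J)` by the exact sequence `0 → 𝔪ʳ/J → R/J → R/𝔪ʳ → 0`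
(adapted from `length_quotient_transform_lt_of_forall_exists`).
[cite: HunekeSwanson2006, Lemma 14.3.4] -/
theorem length_quotient_transform_add_length_le_of_forall_exists
    (hmS : (maximalIdeal R).map (algebraMap R S) = Ideal.span {algebraMap R S x})
    {J : Ideal R} {r : ℕ} (hJ : J ≤ maximalIdeal R ^ r)
    (hsurj : ∀ s : S, ∃ m ∈ maximalIdeal R ^ r,
      algebraMap R S x ^ r * s - algebraMap R S m ∈ J.map (algebraMap R S)) :
    Module.length S (S ⧸ (J.map (algebraMap R S)).colon {algebraMap R S x ^ r}) +
      Module.length R (R ⧸ maximalIdeal R ^ r) ≤ Module.length R (R ⧸ J) := by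
  set x' : S := algebraMap R S x
  set JS : Ideal S := J.map (algebraMap R S)
  -- `σ : S → S/JS`, `s ↦ xʳ s`, with kernel `(JS : xʳ)`
  let σ : S →ₗ[S] S ⧸ JS := (Submodule.mkQ JS).comp (LinearMap.mulLeft S (x' ^ r))
  have hσ : ∀ s, σ s = Submodule.Quotient.mk (x' ^ r * s) := fun s => rfl
  have hkerσ : LinearMap.ker σ = JS.colon {x' ^ r} := by
    ext s
    rw [LinearMap.mem_ker, hσ, Submodule.Quotient.mk_eq_zero, Submodule.mem_colon_singleton,
      smul_eq_mul, mul_comm]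
  -- `θ : 𝔪ʳ → S/JS`, `m ↦ m`, with the same range
  let θ : ↥(maximalIdeal R ^ r) →ₗ[R] S ⧸ JS :=
    ((Submodule.mkQ JS).restrictScalars R).comp
      ((Algebra.linearMap R S).comp (maximalIdeal R ^ r).subtype)
  have hθ : ∀ m, θ m = Submodule.Quotient.mk (algebraMap R S m) := fun m => rfl
  have hrange : (LinearMap.range σ).restrictScalars R = LinearMap.range θ := by
    ext t
    rw [Submodule.restrictScalars_mem, LinearMap.mem_range, LinearMap.mem_range]
    constructor
    · rintro ⟨s, rfl⟩
      obtain ⟨m, hm, hdiff⟩ := hsurj s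
      refine ⟨⟨m, hm⟩, ?_⟩
      rw [hθ, hσ]
      exact ((Submodule.Quotient.eq JS).mpr hdiff).symm
    · rintro ⟨m, rfl⟩
      have hm' : algebraMap R S m ∈ Ideal.span {x' ^ r} := by
        rw [← Ideal.span_singleton_pow, ← hmS, ← Ideal.map_pow]
        exact Ideal.mem_map_of_mem _ m.2
      obtain ⟨s, hs⟩ := Ideal.mem_span_singleton'.mp hm'
      refine ⟨s, ?_⟩
      rw [hσ, hθ, ← hs, mul_comm]
  -- `ι : 𝔪ʳ → R/J` with `ker ι ≤ ker θ` and `range ι = 𝔪ʳ/J = ker (R/J → R/𝔪ʳ)`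
  let ι : ↥(maximalIdeal R ^ r) →ₗ[R] R ⧸ J := (Submodule.mkQ J).comp (maximalIdeal R ^ r).subtype
  have hι : ∀ m, ι m = Submodule.Quotient.mk (m : R) := fun m => rfl
  have hker : LinearMap.ker ι ≤ LinearMap.ker θ := by
    intro m hm
    rw [LinearMap.mem_ker, hι, Submodule.Quotient.mk_eq_zero] at hm
    rw [LinearMap.mem_ker, hθ, Submodule.Quotient.mk_eq_zero]
    exact Ideal.mem_map_of_mem _ hm
  have hlenθ : Module.length R (LinearMap.range θ) ≤ Module.length R (LinearMap.range ι) := by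
    rw [← (LinearMap.quotKerEquivRange θ).length_eq, ← (LinearMap.quotKerEquivRange ι).length_eq]
    exact Module.length_le_of_surjective _ (Submodule.factor_surjective hker)
  have hexact : Function.Exact (LinearMap.range ι).subtype (Submodule.factor hJ) := by
    rw [LinearMap.exact_iff, Submodule.range_subtype]
    ext t
    obtain ⟨a, rfl⟩ := Submodule.mkQ_surjective J t
    rw [LinearMap.mem_ker, Submodule.factor_mk, Submodule.mkQ_apply,
      Submodule.Quotient.mk_eq_zero, LinearMap.mem_range]
    constructor
    · intro ha
      exact ⟨⟨a, ha⟩, rfl⟩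
    · rintro ⟨m, hm⟩
      rw [hι, Submodule.mkQ_apply, Submodule.Quotient.eq] at hm
      have := sub_mem m.2 (hJ hm)
      rwa [sub_sub_cancel] at this
  have hsum : Module.length R (R ⧸ J) =
      Module.length R (LinearMap.range ι) + Module.length R (R ⧸ maximalIdeal R ^ r) :=
    Module.length_eq_add_of_exact (LinearMap.range ι).subtype (Submodule.factor hJ)
      (Submodule.subtype_injective _) (Submodule.factor_surjective hJ) hexact
  -- assemble
  have hle : Module.length S (S ⧸ JS.colon {x' ^ r}) ≤ Module.length R (LinearMap.range ι) :=
    calc Module.length S (S ⧸ JS.colon {x' ^ r})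
        = Module.length S (S ⧸ LinearMap.ker σ) := by rw [hkerσ]
      _ = Module.length S (LinearMap.range σ) := (LinearMap.quotKerEquivRange σ).length_eq
      _ ≤ Module.length R ((LinearMap.range σ).restrictScalars R) :=
          Submodule.length_le_length_restrictScalars R _
      _ = Module.length R (LinearMap.range θ) := by rw [hrange]
      _ ≤ Module.length R (LinearMap.range ι) := hlenθ
  rw [hsum]
  exact add_le_add hle le_rfl

end Abstract

open IsLocalRing

/-- **The sharp colength drop of the weak transform at every point of the chart** (Giraud 1983,
Lemme 2.1.1 and Lemme 2.3 (B); quantitative form of Huneke–Swanson 14.3.4): for a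
two-dimensional regular local ring `(R, 𝔪 = (x, y))` of `K`, an ideal `J ⊆ 𝔪ʳ`, `J ⊄ 𝔪ʳ⁺¹`
(`r ≥ 1`) of finite colength and every prime `Q` of `A = R[y/x]`:
`λ_{A_Q}(A_Q/(JA : xʳ)A_Q) + λ_R(R/𝔪ʳ) ≤ λ_R(R/J)` — `A/(JA : xʳ) ≅ xʳA/JA` is an `R`-quotient
of `𝔪ʳ/J` (`exists_pow_mul_sub_mem_map`), `λ_R(𝔪ʳ/J) + λ_R(R/𝔪ʳ) = λ_R(R/J)`, and localisation
does not increase length. [cite: HunekeSwanson2006, Lemma 14.3.4] -/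
theorem length_quotient_weakTransform_map_add_length_le : ∀ {K : Type} [Field K] {R : Subring K} [IsRegularLocalRing R] {x y : R}, ringKrullDim R = 2 → maximalIdeal R = Ideal.span {x, y} → x ≠ 0 → ∀ {J : Ideal R} {r : ℕ}, 1 ≤ r → J ≤ maximalIdeal R ^ r → ¬ J ≤ maximalIdeal R ^ (r + 1) → IsFiniteLength R (R ⧸ J) → ∀ (Q : Ideal (Literature.AlgebraicGeometry.Resolution.chartAdjoin (K := K) x y)) [Q.IsPrime], Module.length (LocalSubring.ofPrime (Literature.AlgebraicGeometry.Resolution.chartAdjoin (K := K) x y) Q).toSubring ((LocalSubring.ofPrime (Literature.AlgebraicGeometry.Resolution.chartAdjoin (K := K) x y) Q).toSubring ⧸ (Literature.AlgebraicGeometry.Resolution.weakTransformChart x y J r).map (algebraMap (Literature.AlgebraicGeometry.Resolution.chartAdjoin (K := K) x y) (LocalSubring.ofPrime (Literature.AlgebraicGeometry.Resolution.chartAdjoin (K := K) x y) Q).toSubring)) + Module.length R (R ⧸ maximalIdeal R ^ r) ≤ Module.length R (R ⧸ J) := by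
  intro K _ R _ x y hdim hm hx0 J r _ hJ hJr hfin Q _
  letI : Algebra R (chartAdjoin (K := K) x y) := (chartIncl x y).toAlgebra
  have hmS : (maximalIdeal R).map (algebraMap R (chartAdjoin (K := K) x y)) =
      Ideal.span {algebraMap R _ x} := map_maximalIdeal_chartIncl hm hx0
  have h1 := length_quotient_transform_add_length_le_of_forall_exists
    (S := chartAdjoin (K := K) x y) hmS hJ (exists_pow_mul_sub_mem_map hdim hm hx0 hJ hJr hfin)
  have h2 := length_quotient_map_le_of_isLocalization
    (L := (LocalSubring.ofPrime (chartAdjoin (K := K) x y) Q).toSubring) Q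
    ((J.map (algebraMap R (chartAdjoin (K := K) x y))).colon
      {algebraMap R (chartAdjoin (K := K) x y) x ^ r})
  exact (add_le_add h2 le_rfl).trans h1

/-- **The Hilbert function of a two-dimensional regular local ring**: `H⁽⁰⁾_R(i) = i + 1`
(`ℓ_R(𝔪ⁱ/𝔪ⁱ⁺¹) = binom(i + 1, i)`, the number of monomials of degree `i` in two variables).
[cite: CossartJannsenSaito2020, Lemma 2.23] -/
theorem hilbertFun_eq_of_ringKrullDim_eq_two {R : Type*} [CommRing R] [IsRegularLocalRing R]
    (hdim : ringKrullDim R = 2) (i : ℕ) : hilbertFun R i = i + 1 := by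
  have hd : (maximalIdeal R).spanFinrank = 2 := by
    have h := IsRegularLocalRing.spanFinrank_maximalIdeal (R := R)
    rw [hdim] at h
    exact_mod_cast h
  have h := length_gradedPiece_eq_hilbertFun R i
  rw [length_gradedPiece_of_isRegularLocalRing (n := i) (hd := hd),
    show i + 2 - 1 = i + 1 by omega, Nat.choose_succ_self_right] at h
  exact_mod_cast h.symm

/-- **Lengths of `R/𝔪ᵐ` in a two-dimensional regular local ring** (Giraud 1983, Lemme 2.3 (B)):
`λ_R(R/𝔪) = 1` (the residue field is a simple module) and `λ_R(R/𝔪ᵐ) ≥ m + 1` for `m ≥ 2`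
(`λ_R(R/𝔪ⁿ⁺¹) = Σ_{i ≤ n} H⁽⁰⁾_R(i) = Σ_{i ≤ n} (i + 1) ≥ 1 + (n + 1)` for `n ≥ 1`).
[cite: CossartJannsenSaito2020, §2.2 (p. 27)] -/
theorem length_quotient_pow_maximalIdeal_ge : ∀ {R : Type*} [CommRing R] [IsRegularLocalRing R], ringKrullDim R = 2 → (Module.length R (R ⧸ maximalIdeal R ^ 1) = 1) ∧ ∀ m : ℕ, 2 ≤ m → ((m + 1 : ℕ) : ℕ∞) ≤ Module.length R (R ⧸ maximalIdeal R ^ m) := by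
  intro R _ _ hdim
  refine ⟨?_, fun m hm => ?_⟩
  · rw [pow_one]
    exact length_residue
  · obtain ⟨k, rfl⟩ : ∃ k, m = k + 2 := ⟨m - 2, by omega⟩
    rw [← sum_hilbertFun_eq_length R (k + 1)]
    have key : k + 2 + 1 ≤ ∑ i ∈ Finset.range (k + 1 + 1), hilbertFun R i := by
      rw [Finset.sum_range_succ, Finset.sum_range_succ', hilbertFun_eq_of_ringKrullDim_eq_two hdim,
        hilbertFun_eq_of_ringKrullDim_eq_two hdim]
      omega
    exact_mod_cast key

end Summit.ResolutionOfSingularities.ResolutionOfSingularities.Theorems.PfaffLine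

end
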